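import Mathlib
import Summits.NavierStokesRegularity.NavierStokesRegularity.Theorems.TaoLadderRungTwoBreakOneShiftWindowRTermDSound
import Summits.NavierStokesRegularity.NavierStokesRegularity.Theorems.TaoLadderRungTwoBreakOneShiftWindowFlatWindow
import HarnessLib

/-!
# The one-shift window system, LXVII: TWIN REALISATIONS — the field difference of TWO ROUGH REALISATIONS of the
# same term data (two admissible tail inputs) over a box, per unit of the tail sup-difference `δ`
# (cell harvest/h2-tao-ladder, seat p2; rung1/RUNG1-P2G16-REPORT.md §83 (K2: the tail sources); support for K1(1) =
# `NoSurvivingDSSOne`, stmt-NavierStokesRegularity-20205)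

MODEL lattice ODEs only (Tao 2016 §4 normal form on Tao's shift set `S`); nothing here is a statement about
the Navier–Stokes equations; no item is closed; nothing numerical is certified. Generic in `ι` (numbered by
`e : ι ≃ Fin n`) and `κ`; data model of part XXX (`RTermD`, `IsRTEncl`).

The tail-sensitivity step of the replay (part XVII `abs_stepSensitivity_le`, hypothesis `hδ`) needs the size of
`F_u(x) − F_v(x)` for two realisations `u`, `v` of the window field whose external (tail) factors differ by at most
`δ` at the current time. This file supplies it from the term data:

* `RFac.udev` (`[-1, 1]` for an external factor, `[0, 0]` for a coordinate) and **`srcRow prec X row`** — the interval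
  `Σ q ⊗ (udev fa ⊗ rval fb ⊕ rval fa ⊗ udev fb)` over the box `X` (the field difference PER UNIT `δ`);
* `Factor.Twin δ` — the real-side relation of two realisations' factors (same coordinate | external values within `δ`);
* **`abs_termField_twin_sub_le`** — `IsRTEncl e Tc T₁ rows RD`, `IsRTEncl e Tc T₂ rows RD`, twin factors at distance
  `δ ≥ 0`, `x` in the box ⇒ `|termField T₁ x i − termField T₂ x i| ≤ mag (srcRow prec X (rrow RD (e i))) · δ`;
* frame level: `OneShiftFrame.shell_cases_of_not_inWindow` (on Tao's shift set a factor shell of a window output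
  that is not a window shell is `-1` or `W`) and **`OneShiftFrame.twin_wterms`** — two tail inputs whose wake shell `-1`
  and top shell `W` differ by at most `δ` at time `t` give twin term lists `wterms T t`, `wterms T' t`.
-/

-- the sub-problem namespace repeats the summit name by design (D-0017)
set_option linter.dupNamespace false

namespace Summit.NavierStokesRegularity.NavierStokesRegularity.Theorems

namespace DSSOneShift

open Set Finset
open Literature.Analysis.FluidPDE Literature.Analysis.FluidPDE.TaoCascade
open Summit.NavierStokesRegularity.NavierStokesRegularity.Theorems.TaylorModelCert
open Summit.NavierStokesRegularity.NavierStokesRegularity.Theorems.TaylorModelReadout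
open Summit.NavierStokesRegularity.NavierStokesRegularity.Theorems.CertificateGlueOn

/-! ### Executable data -/

namespace RFac

/-- Unit deviation box of a factor between two realisations: `[0, 0]` for a coordinate (the same state), `[-1, 1]`
for an external value (per unit of the tail sup-difference). [folklore] -/
def udev : RFac → IntervalD
  | coord _ => IntervalD.ofInt 0
  | ext _ _ => sym (Dyad.ofInt 1)

end RFac

/-- **The twin-source interval of one row over the state box `X`**: `Σ q ⊗ (udev fa ⊗ rval fb ⊕ rval fa ⊗ udev fb)` —
the field difference of two rough realisations per unit tail difference. [cite: Moore1979, §3.2; KapelaZgliczynski2009, §4 (perturbation size); cell vocabulary, harvest/h2-tao-ladder rung1/RUNG1-P2G16-REPORT.md §83 (β_b, β_e)] -/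
def srcRow (prec : ℕ) (X : Array IntervalD) : List RTermD → IntervalD
  | [] => IntervalD.ofInt 0
  | t :: l => IntervalD.addR prec
      (IntervalD.mulR prec t.1 (IntervalD.addR prec (IntervalD.mulR prec t.2.1.udev (t.2.2.rval X))
        (IntervalD.mulR prec (t.2.1.rval X) t.2.2.udev)))
      (srcRow prec X l)

/-! ### The real-side relation of two realisations -/

/-- **Twin factors at distance `δ`**: the same coordinate, or two external values within `δ` of each other (a
bookkeeping predicate of the term-list data model: two tail realisations read through the same data).
[cite: Tao2016AveragedNS, §4 (4.8); cell vocabulary, harvest/h2-tao-ladder rung1/KERNEL-CHEAP-REPLAY-SPEC.md §1 (tube), rung1/RUNG1-P2G16-REPORT.md §83] -/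
def Factor.Twin {ι : Type*} (δ : ℝ) : Factor ι → Factor ι → Prop
  | Factor.coord c, Factor.coord c' => c = c'
  | Factor.ext a, Factor.ext b => |a - b| ≤ δ
  | _, _ => False

variable {ι : Type*} [Fintype ι] [DecidableEq ι] {κ : Type*} [Fintype κ] {n : ℕ} (e : ι ≃ Fin n)
  {Tc T₁ T₂ : κ → BTerm ι}

omit [Fintype ι] [DecidableEq ι] in
/-- A twin pair of factors matched to the same data factor: both values lie in `rval`, and their difference is
`δ · θ` with `θ ∈ udev`. [folklore] -/
theorem twin_vals {δ : ℝ} (hδ : 0 ≤ δ) {d : RFac} {φc φ₁ φ₂ : Factor ι} (h₁ : FacOK e d φc φ₁) (h₂ : FacOK e d φc φ₂)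
    (ht : Factor.Twin δ φ₁ φ₂) {X : Array IntervalD} {x : ι → ℝ} (hx : ∀ i, IntervalD.mem (x i) (IntervalD.aget X (e i))) :
    IntervalD.mem (φ₁.val x) (d.rval X) ∧ IntervalD.mem (φ₂.val x) (d.rval X) ∧
      ∃ θ : ℝ, IntervalD.mem θ d.udev ∧ φ₁.val x - φ₂.val x = δ * θ := by
  refine ⟨(mem_vals e h₁ hx).2.1, (mem_vals e h₂ hx).2.1, ?_⟩
  cases d with
  | coord c =>
    obtain ⟨i, hi, rfl, rfl⟩ := h₁
    obtain ⟨i', hi', hci, rfl⟩ := h₂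
    cases hci
    refine ⟨0, by simpa [RFac.udev] using IntervalD.mem_ofInt 0, ?_⟩
    simp [Factor.val]
  | ext cen rad =>
    obtain ⟨rc, rt, rfl, rfl, -, -, -⟩ := h₁
    obtain ⟨rc', rt', hcc, rfl, -, -, -⟩ := h₂
    have ht' : |rt - rt'| ≤ δ := ht
    by_cases hδ0 : δ = 0
    · refine ⟨0, mem_sym (by simp), ?_⟩
      have : rt - rt' = 0 := by
        have h0 : |rt - rt'| ≤ 0 := by simpa [hδ0] using ht'
        exact abs_eq_zero.1 (le_antisymm h0 (abs_nonneg _))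
      simp [Factor.val, this, hδ0]
    · have hδp : 0 < δ := lt_of_le_of_ne hδ (Ne.symm hδ0)
      refine ⟨(rt - rt') / δ, mem_sym ?_, ?_⟩
      · rw [abs_div, abs_of_pos hδp, div_le_iff₀ hδp, Dyad.toReal_ofInt]
        simpa using ht'
      · simp only [Factor.val]
        field_simp

omit [Fintype ι] [DecidableEq ι] [Fintype κ] in
/-- One row of the twin difference is `δ ·` a member of `srcRow`. [folklore] -/
theorem exists_mem_srcRow (prec : ℕ) {δ : ℝ} (hδ : 0 ≤ δ) {X : Array IntervalD} {x : ι → ℝ}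
    (hx : ∀ i, IntervalD.mem (x i) (IntervalD.aget X (e i)))
    (ht : ∀ k, Factor.Twin δ (T₁ k).fa (T₂ k).fa ∧ Factor.Twin δ (T₁ k).fb (T₂ k).fb) :
    ∀ {dl : List RTermD} {kl : List κ}, List.Forall₂ (fun d k => TermOK e d (Tc k) (T₁ k)) dl kl →
      List.Forall₂ (fun d k => TermOK e d (Tc k) (T₂ k)) dl kl →
      ∃ r : ℝ, IntervalD.mem r (srcRow prec X dl) ∧
        (kl.map fun k => (Tc k).coef * ((T₁ k).fa.val x * (T₁ k).fb.val x - (T₂ k).fa.val x * (T₂ k).fb.val x)).sum = δ * r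
  | _, _, List.Forall₂.nil, _ => ⟨0, by simpa [srcRow] using IntervalD.mem_ofInt 0, by simp⟩
  | _, _, List.Forall₂.cons (a := d) (b := k) h hl, h2 => by
    obtain ⟨h', hl'⟩ := List.forall₂_cons.1 h2
    obtain ⟨hq, -, hfa, hfb⟩ := h
    obtain ⟨-, -, hfa', hfb'⟩ := h'
    obtain ⟨ha1, ha2, θa, hθa, hda⟩ := twin_vals e hδ hfa hfa' (ht k).1 hx
    obtain ⟨hb1, hb2, θb, hθb, hdb⟩ := twin_vals e hδ hfb hfb' (ht k).2 hx
    obtain ⟨r, hr, hsum⟩ := exists_mem_srcRow prec hδ hx ht hl hl'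
    refine ⟨(Tc k).coef * (θa * (T₁ k).fb.val x + (T₂ k).fa.val x * θb) + r, ?_, ?_⟩
    · rw [srcRow]
      exact IntervalD.mem_addR prec (IntervalD.mem_mulR prec hq (IntervalD.mem_addR prec
        (IntervalD.mem_mulR prec hθa hb1) (IntervalD.mem_mulR prec ha2 hθb))) hr
    · rw [List.map_cons, List.sum_cons, hsum]
      have e1 : (T₁ k).fa.val x * (T₁ k).fb.val x - (T₂ k).fa.val x * (T₂ k).fb.val x =
          ((T₁ k).fa.val x - (T₂ k).fa.val x) * (T₁ k).fb.val x +
            (T₂ k).fa.val x * ((T₁ k).fb.val x - (T₂ k).fb.val x) := by ring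
      rw [e1, hda, hdb]
      ring

omit [Fintype ι] in
/-- **THE TWIN FIELD DIFFERENCE BOUND**: two rough realisations of the same term data whose factors are twins at
distance `δ ≥ 0` differ on the box `X` by at most `mag (srcRow prec X row_i) · δ` in component `i` — the `cb B + ce E`
of part XVII with `B = E = δ`. [cite: KapelaZgliczynski2009, §4 (perturbation size); Moore1979, §3.2; cell vocabulary, harvest/h2-tao-ladder rung1/RUNG1-P2G16-REPORT.md §83] -/
theorem abs_termField_twin_sub_le {rows : ι → List κ} {RD : RRows} (h₁ : IsRTEncl e Tc T₁ rows RD)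
    (h₂ : IsRTEncl e Tc T₂ rows RD) {δ : ℝ} (hδ : 0 ≤ δ)
    (ht : ∀ k, Factor.Twin δ (T₁ k).fa (T₂ k).fa ∧ Factor.Twin δ (T₁ k).fb (T₂ k).fb) (prec : ℕ)
    {X : Array IntervalD} {x : ι → ℝ} (hx : ∀ i, IntervalD.mem (x i) (IntervalD.aget X (e i))) (i : ι) :
    |termField T₁ x i - termField T₂ x i| ≤ (IntervalD.mag (srcRow prec X (rrow RD (e i)))).toReal * δ := by
  obtain ⟨hrows, hsame₁, hdata₁⟩ := h₁
  obtain ⟨-, hsame₂, hdata₂⟩ := h₂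
  have hdiff : termField T₁ x i - termField T₂ x i =
      ((rows i).map fun k => (Tc k).coef * ((T₁ k).fa.val x * (T₁ k).fb.val x - (T₂ k).fa.val x * (T₂ k).fb.val x)).sum := by
    rw [termField, termField, ← Finset.sum_sub_distrib, ← hrows i]
    refine Finset.sum_congr rfl fun k _ => ?_
    rw [coefAt_eq_of_same hsame₁, coefAt_eq_of_same hsame₂]; ring
  obtain ⟨r, hr, hsum⟩ := exists_mem_srcRow e prec hδ hx ht (hdata₁ i) (hdata₂ i)
  rw [hdiff, hsum, abs_mul, abs_of_nonneg hδ, mul_comm]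
  exact mul_le_mul_of_nonneg_right (IntervalD.abs_le_mag hr) hδ

omit [Fintype ι] [DecidableEq ι] [Fintype κ] in
/-- `mag (srcRow …)` is non-negative. [folklore] -/
theorem srcRow_mag_nonneg (prec : ℕ) (X : Array IntervalD) (row : List RTermD) :
    0 ≤ (IntervalD.mag (srcRow prec X row)).toReal := by
  simp only [IntervalD.mag, Dyad.toReal_max, Dyad.toReal_abs]
  exact (abs_nonneg _).trans (le_max_left _ _)

/-! ### Frame level: two tail inputs give twin term lists -/

namespace OneShiftFrame

variable {m : ℕ} (F : OneShiftFrame m)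

/-- **On Tao's shift set the factor shells of a window output are `j − 1`, `j`, `j + 1`**: a factor shell that is not
a window shell is the wake shell `-1` or the top shell `W`. [cite: Tao2016AveragedNS, §4 after (4.1) (S = {(0,0,0),(1,0,0),(0,1,0),(0,0,1)})] -/
theorem shell_cases_of_not_inWindow (j : Fin F.W) {μ : ℤ × ℤ × ℤ} (hμ : μ ∈ shiftSet) {ν : ℤ}
    (hν : ν = μ.1 ∨ ν = μ.2.1) {k : ℤ} (hk : k = ((j : ℕ) : ℤ) - μ.2.2 + ν) (hkw : ¬ F.InWindow k) :
    k = -1 ∨ k = F.W := by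
  have hj : ((j : ℕ) : ℤ) < F.W := by exact_mod_cast j.isLt
  have hj0 : (0 : ℤ) ≤ ((j : ℕ) : ℤ) := by positivity
  simp only [OneShiftFrame.InWindow, not_and_or, not_le, not_lt] at hkw
  rcases (mem_shiftSet_iff μ).1 hμ with h | h | h | h <;> subst h <;> simp only at hν hk <;>
    rcases hν with rfl | rfl <;> omega

/-- **Two tail inputs whose wake shell `-1` and top shell `W` differ by at most `δ` at time `t` give twin term
lists** `wterms T t`, `wterms T' t` at distance `δ`. [cite: Tao2016AveragedNS, §4 Lemma 4.1 (4.8); cell vocabulary, harvest/h2-tao-ladder rung1/RUNG1-P2G16-REPORT.md §83 (the tails enter only the rows of shells 0 and W−1)] -/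
theorem twin_wterms (ε₀ : ℝ) (α : Fin m → Fin m → Fin m → ℤ × ℤ × ℤ → ℝ) {T T' : Fin m → ℤ → ℝ → ℝ} {t δ : ℝ}
    (hB : ∀ i, |T i (-1) t - T' i (-1) t| ≤ δ) (hE : ∀ i, |T i F.W t - T' i F.W t| ≤ δ) (q : F.TIdx) :
    Factor.Twin δ (F.wterms ε₀ α T t q).fa (F.wterms ε₀ α T' t q).fa ∧
      Factor.Twin δ (F.wterms ε₀ α T t q).fb (F.wterms ε₀ α T' t q).fb := by
  have hμ : q.2.2.2.1 ∈ shiftSet := Finset.mem_coe.1 q.2.2.2.2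
  have key : ∀ (i : Fin m) {ν : ℤ} (hν : ν = q.2.2.2.1.1 ∨ ν = q.2.2.2.1.2.1),
      Factor.Twin δ (F.factorAt T t i (((q.1.2 : ℕ) : ℤ) - q.2.2.2.1.2.2 + ν))
        (F.factorAt T' t i (((q.1.2 : ℕ) : ℤ) - q.2.2.2.1.2.2 + ν)) := by
    intro i ν hν
    set k : ℤ := ((q.1.2 : ℕ) : ℤ) - q.2.2.2.1.2.2 + ν with hk
    by_cases hkw : F.InWindow k
    · simp only [factorAt, dif_pos hkw]
      exact rfl
    · simp only [factorAt, dif_neg hkw]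
      show |T i k t - T' i k t| ≤ δ
      rcases F.shell_cases_of_not_inWindow q.1.2 hμ hν hk hkw with h | h
      · rw [h]; exact hB i
      · rw [h]; exact hE i
  exact ⟨key q.2.1 (Or.inl rfl), key q.2.2.1 (Or.inr rfl)⟩

end OneShiftFrame

end DSSOneShift

end Summit.NavierStokesRegularity.NavierStokesRegularity.Theorems
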